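import Literature.MathematicalPhysics.QuantumFieldTheory.Balaban1983to89.HaarSmallBallClosedSubgroup

/-!
# HAAR MEASURE OF SMALL BALLS ON EVERY COMPACT SUBGROUP OF `U(N)`: THE UPPER BOUND WITH THE EXPONENT `dim 𝔤`, AND
# THE TWO-SIDED ESTIMATE `C⁻¹r^d ≤ μ{‖ρ(g) − 1‖ ≤ r} ≤ Cr^d` ([VaropoulosSaloffcosteCoulhon1993] Thm. V.4.1 for compact
# linear groups, operator-norm balls) — `HaarSmallBallTwoSided`, companion of `HaarSmallBallClosedSubgroup`

statement-level skeleton of published theorems with citation tags; proofs where landed; nothing here is a claim about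
the Yang–Mills mass gap

CITATION HEADER.  Cell `lit-balaban` (Phase-2 proof seat p24, gen 9; free-target protocol G.5-34(d), own Lie-theory
lane; HOME `run/shared/lean/pub/lit-balaban/`, seat dir `lit-balaban-p24/`).  Sources: N. T. Varopoulos,
L. Saloff-Coste, T. Coulhon, *Analysis and Geometry on Groups*, CUP (1992) [VaropoulosSaloffcosteCoulhon1993] (held
`book:varopoulos1993-analysis-geometry-groups`, PDF p. 97), Thm. V.4.1: «There exists C > 0 such that ∀ t ∈ ]0,1[,
C⁻¹t^d < V(t) ≦ Ct^d.» (connected unimodular Lie group with Haar measure, `V(t)` = the Haar measure of the ball of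
radius `t`, `d` the local dimension = `dim G` for a spanning system); B. C. Hall, *Lie Groups, Lie Algebras, and
Representations*, 2nd ed. (2015) [Hall2015], Cor. 3.44 («the exponential map takes U homeomorphically onto V»);
T. Bałaban, Commun. Math. Phys. **109** (1987) 249–301 [Balaban1987RG1], §0 pp. 251–252 («G … a Lie subgroup of a group
of complex unitary matrices, for example G ⊂ U(N)»; `|·|` = operator norm, [Balaban1985Averaging] (19) p. 21).

WHAT THE TREE HAD.  The LOWER half for every compact group presented in `U(N)` (this seat, file 1:
`HaarSmallBallClosedSubgroup.haar_ball_ge_of_unitaryRep`, `μ{‖ρ(g) − 1‖ ≤ r} ≥ c·r^d`), whose header records «Only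
the LOWER bound of Thm. V.4.1 is proved».  THIS FILE PROVES THE UPPER HALF AND ASSEMBLES THE PRINTED TWO-SIDED FORM.

WHAT THIS FILE PROVES (0 `sorry`; theorems only; standard axioms):
* §1 `exists_exp_expansion_radius` — near `0`, `exp` does not contract by more than a factor `2`:
  `‖X − Y‖ ≤ 2‖exp X − exp Y‖` for `‖X‖, ‖Y‖ < s` (strict differentiability of `exp` at `0` with derivative `id`,
  Mathlib `hasStrictFDerivAt_exp_zero`) — the metric content of «homeomorphically onto V».
* §2 `exists_separated_net`, `pow_le_card_of_net` — PACKING BY VOLUME from below: a maximal `t`-separated subset of the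
  ball `{‖x‖ ≤ s}` of a `d`-dimensional real normed space is a `t`-net, hence has at least `(s/t)^d` points (Lebesgue
  measure scaling, `Measure.addHaar_real_closedBall'`).
* §3 **`haar_ball_le_of_unitaryRep`** — THE UPPER BOUND: for every compact group `G` with a continuous unitary
  representation `ρ : G →* M_N(ℂ)` there is `C > 0` such that for EVERY left-invariant probability measure `μ` on `G`
  and ALL `r > 0`, `μ{g : ‖ρ(g) − 1‖ ≤ r} ≤ C·r^d`, `d = dim_ℝ 𝔤(ρ(G))` (`QuantumLattice.matrixLieAlgebra (range ρ)`):
  `≥ (s/5r)^d` points `X_i ∈ 𝔤`, `‖X_i‖ ≤ s`, pairwise `5r`-separated give group elements `exp X_i ∈ ρ(G)` pairwise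
  more than `2r` apart (§1), hence DISJOINT left translates of the ball, so `#F·μ(ball) ≤ 1`.
* §4 **`haar_ball_two_sided_of_unitaryRep`** — Thm. V.4.1 AS PRINTED (both halves, one constant) for compact linear
  groups in the operator-norm distance: for every `R > 0` there is `C > 0` with
  `C⁻¹·r^d ≤ μ.real{‖ρ(g) − 1‖ ≤ r} ≤ C·r^d` for all `0 < r ≤ R` and every left-invariant probability `μ`;
  `haar_ball_two_sided_of_closedSubgroup` — the same for every closed subgroup `G ≤ U(N)` (print's «G ⊂ U(N) a Lie
  subgroup») with `d = dim` of the Lie algebra of gen 8's `unitarySubgroupLogChart G`.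

HONEST SCOPE.  (a) Constants NON-explicit (a strict-differentiability radius of `exp`; file 1's compactness constants).
(b) Operator-norm balls (B12's `|·|`), not print's Carnot–Carathéodory∕Riemannian balls; print's `G` is connected, here
any compact `G` (the identity component decides `d`).  (c) `V(t) ≤ Ct^d` holds here for ALL `t > 0` (trivially for
large `t` since `μ ≤ 1`), the lower bound on `(0, R]`.  (d) No consumer in the cell needs the upper half; it is proved to
serve the cited theorem in full.  Nothing of Bałaban's analysis is asserted.
-/

noncomputable section

open NormedSpace Metric Set Filter Topology MeasureTheory Asymptotics
open scoped ENNReal NNReal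

namespace Literature.MathematicalPhysics.QuantumFieldTheory.Balaban1983to89.HaarSmallBallClosedSubgroup

open LogChartClosedSubgroup (lieOf mem_lieOf_iff exp_mem_of_mem_lieOf closedSubgroupLogChart
  unitarySubgroupLogChart)
open Literature.MathematicalPhysics.QuantumLattice (matrixLieAlgebra unitaryFundamentalRep)

/-! ## §1 `exp` expands distances by at most a factor `2⁻¹` near `0` -/

section ExpExpansion

variable {𝔸 : Type*} [NormedRing 𝔸] [NormedAlgebra ℝ 𝔸] [CompleteSpace 𝔸]

/-- **Near `0` the exponential is injective with Lipschitz inverse**: there is `s > 0` with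
`‖X − Y‖ ≤ 2‖exp X − exp Y‖` whenever `‖X‖, ‖Y‖ < s` — from the STRICT differentiability of `exp` at `0` with derivative
the identity (`‖exp X − exp Y − (X − Y)‖ ≤ ½‖X − Y‖` near `(0, 0)`).  The metric form of «the exponential map takes U
homeomorphically onto V». [cite: Hall2015, Cor. 3.44] -/
theorem exists_exp_expansion_radius :
    ∃ s : ℝ, 0 < s ∧ ∀ X Y : 𝔸, ‖X‖ < s → ‖Y‖ < s → ‖X - Y‖ ≤ 2 * ‖exp X - exp Y‖ := by
  have h := (hasStrictFDerivAt_exp_zero (𝕂 := ℝ) (𝔸 := 𝔸)).isLittleO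
  have h2 := h.def (by norm_num : (0 : ℝ) < 1 / 2)
  obtain ⟨s, hs, hball⟩ := Metric.eventually_nhds_iff.1 h2
  refine ⟨s, hs, fun X Y hX hY => ?_⟩
  have hmem : dist ((X, Y) : 𝔸 × 𝔸) ((0, 0) : 𝔸 × 𝔸) < s := by
    rw [dist_eq_norm, Prod.norm_def]
    simp only [Prod.fst_sub, Prod.snd_sub, sub_zero]
    exact max_lt hX hY
  have hest : ‖exp X - exp Y - (X - Y)‖ ≤ 1 / 2 * ‖X - Y‖ := by
    have h' := hball hmem
    change ‖exp X - exp Y - (X - Y)‖ ≤ 1 / 2 * ‖X - Y‖ at h'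
    exact h'
  have htri : ‖X - Y‖ ≤ ‖exp X - exp Y‖ + ‖exp X - exp Y - (X - Y)‖ := by
    have := norm_sub_le (exp X - exp Y) (exp X - exp Y - (X - Y))
    rwa [sub_sub_cancel] at this
  linarith

end ExpExpansion

/-! ## §2 Packing by volume from below: many separated points in a ball -/

section Packing

variable {E : Type*} [NormedAddCommGroup E] [NormedSpace ℝ E] [FiniteDimensional ℝ E]

/-- **A maximal separated subset is a net.**  For `s ≥ 0`, `t > 0` there is a finite `F ⊆ {‖x‖ ≤ s}`, pairwise
`t`-separated (`t ≤ ‖x − y‖`), such that every point of the ball is within `< t` of `F` (maximality; the cardinality of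
separated subsets is bounded by the packing bound `card_le_of_separated_of_dist_le`).
[cite: VaropoulosSaloffcosteCoulhon1993, Thm. V.4.1] -/
theorem exists_separated_net {s t : ℝ} (hs : 0 ≤ s) (ht : 0 < t) :
    ∃ F : Finset E, (∀ y ∈ F, ‖y‖ ≤ s) ∧ (∀ x ∈ F, ∀ y ∈ F, x ≠ y → t ≤ ‖x - y‖) ∧
      ∀ x : E, ‖x‖ ≤ s → ∃ y ∈ F, ‖x - y‖ < t := by
  classical
  let good : Finset E → Prop := fun F =>
    (∀ y ∈ F, ‖y‖ ≤ s) ∧ (∀ x ∈ F, ∀ y ∈ F, x ≠ y → t ≤ dist x y)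
  have hcardR : ∀ F, good F → (F.card : ℝ) ≤ (2 * s / t + 1) ^ Module.finrank ℝ E := fun F hF =>
    Literature.MathematicalPhysics.StatisticalMechanics.card_le_of_separated_of_dist_le F 0 ht hs
      (fun c hc => by rw [dist_zero_right]; exact hF.1 c hc) hF.2
  let P : ℕ → Prop := fun k => ∃ F, good F ∧ F.card = k
  set Bd : ℕ := ⌊(2 * s / t + 1) ^ Module.finrank ℝ E⌋₊ with hBd
  have hcard : ∀ F, good F → F.card ≤ Bd := fun F hF => Nat.le_floor (hcardR F hF)
  have hP0 : P 0 := ⟨∅, ⟨by simp, by simp⟩, rfl⟩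
  obtain ⟨F₀, hgood, hcardF₀⟩ : P (Nat.findGreatest P Bd) := Nat.findGreatest_spec (Nat.zero_le Bd) hP0
  refine ⟨F₀, hgood.1, fun x hx y hy hxy => by rw [← dist_eq_norm]; exact hgood.2 x hx y hy hxy, fun x hx => ?_⟩
  by_contra hcon
  push Not at hcon
  have hxF : x ∉ F₀ := by
    intro hxF
    have := hcon x hxF
    rw [sub_self, norm_zero] at this
    linarith
  have hgood' : good (insert x F₀) := by
    refine ⟨fun y hy => ?_, fun a ha b hb hab => ?_⟩
    · rcases Finset.mem_insert.1 hy with hy | hy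
      · rw [hy]; exact hx
      · exact hgood.1 y hy
    · rcases Finset.mem_insert.1 ha with ha | ha <;> rcases Finset.mem_insert.1 hb with hb | hb
      · exact absurd (ha.trans hb.symm) hab
      · rw [ha, dist_eq_norm]; exact hcon b hb
      · rw [hb, dist_comm, dist_eq_norm]; exact hcon a ha
      · exact hgood.2 a ha b hb hab
  have hP1 : P (Nat.findGreatest P Bd + 1) :=
    ⟨insert x F₀, hgood', by rw [Finset.card_insert_of_notMem hxF, hcardF₀]⟩
  have hle : Nat.findGreatest P Bd + 1 ≤ Bd := by
    have := hcard _ hgood'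
    rwa [Finset.card_insert_of_notMem hxF, hcardF₀] at this
  exact Nat.findGreatest_is_greatest (Nat.lt_succ_self _) hle hP1

/-- **Packing by volume, from below.**  If every point of `{‖x‖ ≤ s}` is within `≤ t` of the finite set `F`
(`0 ≤ s`, `0 < t`), then `(s/t)^d ≤ #F`: `vol{‖x‖ ≤ s} ≤ #F·vol{‖x‖ ≤ t}` and Lebesgue measure scales with the power
`d = dim E`. [cite: VaropoulosSaloffcosteCoulhon1993, Thm. V.4.1] -/
theorem pow_le_card_of_net {s t : ℝ} (hs : 0 ≤ s) (ht : 0 < t) (F : Finset E)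
    (hcov : ∀ x : E, ‖x‖ ≤ s → ∃ y ∈ F, ‖x - y‖ ≤ t) :
    (s / t) ^ Module.finrank ℝ E ≤ F.card := by
  classical
  borelize E
  set μ : Measure E := Measure.addHaar with hμ
  set d : ℕ := Module.finrank ℝ E with hd
  have hsub : closedBall (0 : E) s ⊆ ⋃ y ∈ F, closedBall y t := by
    intro x hx
    rw [mem_closedBall_zero_iff] at hx
    obtain ⟨y, hy, hxy⟩ := hcov x hx
    exact mem_iUnion₂.2 ⟨y, hy, by rw [mem_closedBall, dist_eq_norm]; exact hxy⟩
  have hUfin : μ (⋃ y ∈ F, closedBall y t) ≠ ⊤ :=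
    ((measure_biUnion_finset_le F _).trans_lt
      (ENNReal.sum_lt_top.2 fun y _ => measure_closedBall_lt_top)).ne
  have h1 : μ.real (closedBall (0 : E) s) ≤ ∑ y ∈ F, μ.real (closedBall y t) :=
    (measureReal_mono hsub hUfin).trans (measureReal_biUnion_finset_le F _)
  have hB : 0 < μ.real (closedBall (0 : E) 1) := by
    rw [measureReal_def]
    exact ENNReal.toReal_pos (measure_closedBall_pos μ _ zero_lt_one).ne' measure_closedBall_lt_top.ne
  rw [Measure.addHaar_real_closedBall' μ 0 hs] at h1
  simp only [Measure.addHaar_real_closedBall' μ _ ht.le, Finset.sum_const, nsmul_eq_mul] at h1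
  -- h1 : s ^ d * B ≤ #F * (t ^ d * B)
  have h2 : s ^ d ≤ F.card * t ^ d := by
    have := h1
    rw [← mul_assoc] at this
    exact le_of_mul_le_mul_right this hB
  rw [div_pow, div_le_iff₀ (pow_pos ht d)]
  exact h2

/-- **Many separated points in a ball**: for `0 ≤ s`, `0 < t` there are at least `(s/t)^d` points of `{‖x‖ ≤ s}`
pairwise at distance `≥ t`. [cite: VaropoulosSaloffcosteCoulhon1993, Thm. V.4.1] -/
theorem exists_separated_card_ge {s t : ℝ} (hs : 0 ≤ s) (ht : 0 < t) :
    ∃ F : Finset E, (∀ y ∈ F, ‖y‖ ≤ s) ∧ (∀ x ∈ F, ∀ y ∈ F, x ≠ y → t ≤ ‖x - y‖) ∧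
      (s / t) ^ Module.finrank ℝ E ≤ F.card := by
  obtain ⟨F, hFs, hsep, hnet⟩ := exists_separated_net (E := E) hs ht
  exact ⟨F, hFs, hsep, pow_le_card_of_net hs ht F fun x hx => by
    obtain ⟨y, hy, hxy⟩ := hnet x hx
    exact ⟨y, hy, hxy.le⟩⟩

end Packing

/-! ## §3 The upper bound `μ{‖ρ(g) − 1‖ ≤ r} ≤ C·r^{dim 𝔤}` -/

section Upper

open scoped Matrix.Norms.L2Operator

variable {n : Type*} [Fintype n] [DecidableEq n]

/-- For a unitary `u` and any `A`: `‖uA‖ ≤ ‖A‖` (operator norm). [cite: Balaban1985Averaging, (19) p.21] -/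
theorem norm_mul_le_of_mem_unitaryGroup {u : Matrix n n ℂ} (hu : u ∈ Matrix.unitaryGroup n ℂ)
    (A : Matrix n n ℂ) : ‖u * A‖ ≤ ‖A‖ := by
  obtain h0 | h0 := subsingleton_or_nontrivial (Matrix n n ℂ)
  · rw [Subsingleton.elim (u * A) A]
  · calc ‖u * A‖ ≤ ‖u‖ * ‖A‖ := norm_mul_le _ _
      _ = ‖A‖ := by rw [CStarRing.norm_of_mem_unitary hu, one_mul]

variable {G : Type*} [Group G] [TopologicalSpace G] [IsTopologicalGroup G] [CompactSpace G]
  [MeasurableSpace G] [BorelSpace G]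

omit [TopologicalSpace G] [IsTopologicalGroup G] [CompactSpace G] [MeasurableSpace G] [BorelSpace G] in
/-- Along a unitary representation, `‖ρ(g) − ρ(k)‖ ≤ ‖ρ(k⁻¹g) − 1‖` (in fact equality): the left translate by `k` of
the ball `{‖ρ(·) − 1‖ ≤ r}` is contained in `{‖ρ(·) − ρ(k)‖ ≤ r}`. [cite: Balaban1985Averaging, (19) p.21] -/
theorem norm_rep_sub_rep_le (ρ : G →* Matrix n n ℂ) (hρu : ∀ g, ρ g ∈ Matrix.unitaryGroup n ℂ) (k g : G) :
    ‖ρ g - ρ k‖ ≤ ‖ρ (k⁻¹ * g) - 1‖ := by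
  have hcalc : ρ g - ρ k = ρ k * (ρ (k⁻¹ * g) - 1) := by
    rw [mul_sub, mul_one, ← map_mul, mul_inv_cancel_left]
  rw [hcalc]
  exact norm_mul_le_of_mem_unitaryGroup (hρu k) _

/-- **HAAR MEASURE OF SMALL BALLS ON A COMPACT GROUP PRESENTED IN `U(N)`: THE UPPER BOUND WITH THE EXPONENT
`d = dim 𝔤`.**  For a compact group `G` with a continuous unitary representation `ρ : G →* M_N(ℂ)` there is `C > 0`
such that for EVERY left-invariant probability measure `μ` on `G` and ALL `r > 0`,
`μ{g : ‖ρ(g) − 1‖ ≤ r} ≤ C·r^d`, `d = dim_ℝ 𝔤(ρ(G))` — «V(t) ≦ Ct^d».  Proof: with `s` an expansion radius of `exp`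
(§1), `≥ (s/2)/(5r))^d` points `X_i ∈ 𝔤`, `‖X_i‖ ≤ s/2`, pairwise `5r`-separated (§2) have images `exp X_i ∈ ρ(G)`
pairwise `> 2r` apart, so the left translates of the ball by preimages `γ_i` are pairwise disjoint and
`#F·μ(ball) ≤ μ(G) = 1`. [cite: VaropoulosSaloffcosteCoulhon1993, Thm. V.4.1] -/
theorem haar_ball_le_of_unitaryRep (ρ : G →* Matrix n n ℂ) (hρc : Continuous ρ)
    (hρu : ∀ g, ρ g ∈ Matrix.unitaryGroup n ℂ) :
    ∃ C : ℝ, 0 < C ∧ ∀ (μ : Measure G) [IsProbabilityMeasure μ] [μ.IsMulLeftInvariant] (r : ℝ), 0 < r →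
      μ {g : G | ‖ρ g - 1‖ ≤ r} ≤ ENNReal.ofReal (C * r ^ Module.finrank ℝ (matrixLieAlgebra (Set.range ρ))) := by
  classical
  set K : Set (Matrix n n ℂ) := Set.range ρ with hKdef
  have hKc : IsCompact K := isCompact_range hρc
  have h1 : (1 : Matrix n n ℂ) ∈ K := ⟨1, map_one ρ⟩
  have hmul : ∀ a ∈ K, ∀ b ∈ K, a * b ∈ K := by
    rintro _ ⟨x, rfl⟩ _ ⟨y, rfl⟩
    exact ⟨x * y, map_mul ρ x y⟩
  have hinv : ∀ a ∈ K, ∃ b ∈ K, b * a = 1 := by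
    rintro _ ⟨x, rfl⟩
    exact ⟨ρ x⁻¹, ⟨x⁻¹, rfl⟩, by rw [← map_mul, inv_mul_cancel, map_one]⟩
  set 𝔤 : Submodule ℝ (Matrix n n ℂ) := lieOf K hKc.isClosed h1 hmul hinv with h𝔤
  have hlie : 𝔤 = matrixLieAlgebra K :=
    (closedSubgroupLogChart K hKc.isClosed h1 hmul hinv).lie_eq_matrixLieAlgebra
  have hd : Module.finrank ℝ 𝔤 = Module.finrank ℝ (matrixLieAlgebra K) := by rw [hlie]
  set d : ℕ := Module.finrank ℝ (matrixLieAlgebra K) with hddef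
  -- expansion radius of `exp`
  obtain ⟨s, hs, hexp⟩ := exists_exp_expansion_radius (𝔸 := Matrix n n ℂ)
  set s' : ℝ := s / 2 with hs'def
  have hs' : 0 < s' := by positivity
  have hs's : s' < s := by rw [hs'def]; linarith
  -- the constant
  refine ⟨(5 / s') ^ d, by positivity, fun μ _ _ r hr => ?_⟩
  -- separated points in `𝔤 ∩ {‖X‖ ≤ s'}`
  obtain ⟨F, hFs, hsep, hcard⟩ := exists_separated_card_ge (E := 𝔤) hs'.le (by positivity : (0 : ℝ) < 5 * r)
  rw [hd] at hcard
  -- their exponentials lie in `K = range ρ`; choose preimages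
  have hpre : ∀ X ∈ F, ∃ g : G, ρ g = exp ((X : 𝔤) : Matrix n n ℂ) := fun X _ =>
    (exp_mem_of_mem_lieOf X.2 : exp ((X : 𝔤) : Matrix n n ℂ) ∈ K)
  choose! γ hγ using hpre
  set Ball : Set G := {g : G | ‖ρ g - 1‖ ≤ r} with hBall
  have hBallm : MeasurableSet Ball := measurableSet_repBall ρ hρc r
  -- the translates
  let T : 𝔤 → Set G := fun X => (fun g => (γ X)⁻¹ * g) ⁻¹' Ball
  have hTm : ∀ X, MeasurableSet (T X) := fun X => hBallm.preimage (measurable_const_mul _)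
  have hTμ : ∀ X, μ (T X) = μ Ball := fun X => measure_preimage_mul μ _ _
  -- the exponentials are pairwise more than `2r` apart
  have hfar : ∀ X ∈ F, ∀ Y ∈ F, X ≠ Y → 2 * r < ‖ρ (γ X) - ρ (γ Y)‖ := by
    intro X hX Y hY hXY
    rw [hγ X hX, hγ Y hY]
    have hXs : ‖((X : 𝔤) : Matrix n n ℂ)‖ < s := lt_of_le_of_lt (by simpa using hFs X hX) hs's
    have hYs : ‖((Y : 𝔤) : Matrix n n ℂ)‖ < s := lt_of_le_of_lt (by simpa using hFs Y hY) hs's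
    have h5 : 5 * r ≤ ‖X - Y‖ := hsep X hX Y hY hXY
    have h5' : 5 * r ≤ ‖((X : 𝔤) : Matrix n n ℂ) - ((Y : 𝔤) : Matrix n n ℂ)‖ := by simpa using h5
    have he := hexp _ _ hXs hYs
    linarith
  -- hence the translates are pairwise disjoint
  have hdisj : (F : Set 𝔤).PairwiseDisjoint T := by
    intro X hX Y hY hXY
    rw [Function.onFun, Set.disjoint_left]
    intro g hgX hgY
    have h1' : ‖ρ g - ρ (γ X)‖ ≤ r := (norm_rep_sub_rep_le ρ hρu (γ X) g).trans hgX
    have h2' : ‖ρ g - ρ (γ Y)‖ ≤ r := (norm_rep_sub_rep_le ρ hρu (γ Y) g).trans hgY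
    have h3 : ‖ρ (γ X) - ρ (γ Y)‖ ≤ 2 * r := by
      calc ‖ρ (γ X) - ρ (γ Y)‖ = ‖(ρ g - ρ (γ Y)) - (ρ g - ρ (γ X))‖ := by rw [sub_sub_sub_cancel_left]
        _ ≤ ‖ρ g - ρ (γ Y)‖ + ‖ρ g - ρ (γ X)‖ := norm_sub_le _ _
        _ ≤ r + r := add_le_add h2' h1'
        _ = 2 * r := by ring
    exact absurd h3 (not_le.2 (hfar X hX Y hY hXY))
  -- `#F · μ(Ball) ≤ 1`
  have hsum : (F.card : ℝ≥0∞) * μ Ball ≤ 1 := by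
    calc (F.card : ℝ≥0∞) * μ Ball = ∑ X ∈ F, μ (T X) := by
          rw [Finset.sum_congr rfl (fun X _ => hTμ X), Finset.sum_const, nsmul_eq_mul]
      _ = μ (⋃ X ∈ F, T X) := (measure_biUnion_finset hdisj (fun X _ => hTm X)).symm
      _ ≤ μ Set.univ := measure_mono (subset_univ _)
      _ = 1 := measure_univ
  -- in real form
  have hμtop : μ Ball ≠ ⊤ := measure_ne_top μ _
  have hreal : (F.card : ℝ) * (μ Ball).toReal ≤ 1 := by
    have h := ENNReal.toReal_mono ENNReal.one_ne_top hsum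
    simpa [ENNReal.toReal_mul] using h
  -- the count: (s'/(5r))^d ≤ #F
  have hFpos : (0 : ℝ) < F.card := lt_of_lt_of_le (by positivity) hcard
  have hkey : (μ Ball).toReal ≤ (5 / s') ^ d * r ^ d := by
    have h1' : (μ Ball).toReal ≤ 1 / F.card := by
      rw [le_div_iff₀ hFpos, mul_comm]
      exact hreal
    have h2' : 1 / (F.card : ℝ) ≤ 1 / (s' / (5 * r)) ^ d :=
      one_div_le_one_div_of_le (by positivity) hcard
    have h3 : 1 / (s' / (5 * r)) ^ d = (5 / s') ^ d * r ^ d := by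
      rw [← mul_pow, one_div, ← inv_pow]
      congr 1
      field_simp
    calc (μ Ball).toReal ≤ 1 / F.card := h1'
      _ ≤ 1 / (s' / (5 * r)) ^ d := h2'
      _ = (5 / s') ^ d * r ^ d := h3
  calc μ Ball = ENNReal.ofReal ((μ Ball).toReal) := (ENNReal.ofReal_toReal hμtop).symm
    _ ≤ ENNReal.ofReal ((5 / s') ^ d * r ^ d) := ENNReal.ofReal_le_ofReal hkey

/-- Real-valued form of the upper bound: `μ.real{‖ρ(g) − 1‖ ≤ r} ≤ C·r^d` for all `r > 0`.
[cite: VaropoulosSaloffcosteCoulhon1993, Thm. V.4.1] -/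
theorem haarReal_ball_le_of_unitaryRep (ρ : G →* Matrix n n ℂ) (hρc : Continuous ρ)
    (hρu : ∀ g, ρ g ∈ Matrix.unitaryGroup n ℂ) :
    ∃ C : ℝ, 0 < C ∧ ∀ (μ : Measure G) [IsProbabilityMeasure μ] [μ.IsMulLeftInvariant] (r : ℝ), 0 < r →
      μ.real {g : G | ‖ρ g - 1‖ ≤ r} ≤ C * r ^ Module.finrank ℝ (matrixLieAlgebra (Set.range ρ)) := by
  obtain ⟨C, hC, h⟩ := haar_ball_le_of_unitaryRep ρ hρc hρu
  refine ⟨C, hC, fun μ _ _ r hr => ?_⟩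
  rw [measureReal_def]
  exact ENNReal.toReal_le_of_le_ofReal (by positivity) (h μ r hr)

/-! ## §4 [VaropoulosSaloffcosteCoulhon1993] Thm. V.4.1 for compact linear groups: both halves, one constant -/

/-- **`C⁻¹r^d ≤ μ{‖ρ(g) − 1‖ ≤ r} ≤ Cr^d` — THM. V.4.1 OF [VaropoulosSaloffcosteCoulhon1993] FOR EVERY COMPACT GROUP
PRESENTED IN `U(N)`, operator-norm balls, `d = dim_ℝ 𝔤(ρ(G))`**: for every `R > 0` one constant `C > 0` serves both
inequalities for all `0 < r ≤ R` and every left-invariant probability measure `μ` (lower half: file 1,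
`haarReal_ball_ge_of_unitaryRep`; upper half: §3). [cite: VaropoulosSaloffcosteCoulhon1993, Thm. V.4.1] -/
theorem haar_ball_two_sided_of_unitaryRep (ρ : G →* Matrix n n ℂ) (hρc : Continuous ρ)
    (hρu : ∀ g, ρ g ∈ Matrix.unitaryGroup n ℂ) {R : ℝ} (hR : 0 < R) :
    ∃ C : ℝ, 0 < C ∧ ∀ (μ : Measure G) [IsProbabilityMeasure μ] [μ.IsMulLeftInvariant] (r : ℝ), 0 < r → r ≤ R →
      C⁻¹ * r ^ Module.finrank ℝ (matrixLieAlgebra (Set.range ρ)) ≤ μ.real {g : G | ‖ρ g - 1‖ ≤ r} ∧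
        μ.real {g : G | ‖ρ g - 1‖ ≤ r} ≤ C * r ^ Module.finrank ℝ (matrixLieAlgebra (Set.range ρ)) := by
  obtain ⟨c, hc, hc1, hlow⟩ := haarReal_ball_ge_of_unitaryRep ρ hρc hρu hR
  obtain ⟨C, hC, hup⟩ := haarReal_ball_le_of_unitaryRep ρ hρc hρu
  set d : ℕ := Module.finrank ℝ (matrixLieAlgebra (Set.range ρ)) with hd
  refine ⟨max (1 / c) C, lt_max_of_lt_right hC, fun μ _ _ r hr hrR => ⟨?_, ?_⟩⟩
  · have h1 : (max (1 / c) C)⁻¹ ≤ c := by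
      rw [inv_le_comm₀ (by positivity) hc, ← one_div]
      exact le_max_left _ _
    calc (max (1 / c) C)⁻¹ * r ^ d ≤ c * r ^ d := mul_le_mul_of_nonneg_right h1 (by positivity)
      _ ≤ μ.real {g : G | ‖ρ g - 1‖ ≤ r} := hlow μ r hr hrR
  · calc μ.real {g : G | ‖ρ g - 1‖ ≤ r} ≤ C * r ^ d := hup μ r hr
      _ ≤ max (1 / c) C * r ^ d := mul_le_mul_of_nonneg_right (le_max_right _ _) (by positivity)

/-- **Thm. V.4.1 for every closed subgroup `G ≤ U(N)`** (print's «G ⊂ U(N) a Lie subgroup»): for every `R > 0` there is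
`C > 0` with `C⁻¹r^d ≤ μ.real{g ∈ G : ‖g − 1‖ ≤ r} ≤ Cr^d` for all `0 < r ≤ R` and every left-invariant probability
measure `μ` on `G`, `d = dim` of the Lie algebra of gen 8's `unitarySubgroupLogChart G`.
[cite: Balaban1987RG1, §0 pp.251–252] -/
theorem haar_ball_two_sided_of_closedSubgroup (Gs : Subgroup (Matrix.unitaryGroup n ℂ))
    (hG : IsClosed (Gs : Set (Matrix.unitaryGroup n ℂ))) {R : ℝ} (hR : 0 < R) :
    ∃ C : ℝ, 0 < C ∧ ∀ (μ : Measure Gs) [IsProbabilityMeasure μ] [μ.IsMulLeftInvariant] (r : ℝ), 0 < r → r ≤ R →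
      C⁻¹ * r ^ Module.finrank ℝ (unitarySubgroupLogChart Gs hG).lie ≤
          μ.real {g : Gs | ‖((g : Matrix.unitaryGroup n ℂ) : Matrix n n ℂ) - 1‖ ≤ r} ∧
        μ.real {g : Gs | ‖((g : Matrix.unitaryGroup n ℂ) : Matrix n n ℂ) - 1‖ ≤ r} ≤
          C * r ^ Module.finrank ℝ (unitarySubgroupLogChart Gs hG).lie := by
  haveI : CompactSpace Gs := compactSpace_of_isClosed_subgroup Gs hG
  set ρ : Gs →* Matrix n n ℂ := (unitaryFundamentalRep n ℂ).comp Gs.subtype with hρdef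
  have hρc : Continuous ρ := continuous_subtype_val.comp continuous_subtype_val
  have hρu : ∀ g : Gs, ρ g ∈ Matrix.unitaryGroup n ℂ := fun g => (g : Matrix.unitaryGroup n ℂ).2
  have hlie : (unitarySubgroupLogChart Gs hG).lie = matrixLieAlgebra (Set.range ρ) := by
    rw [hρdef, range_unitaryFundamentalRep_comp_subtype]
    exact (unitarySubgroupLogChart Gs hG).lie_eq_matrixLieAlgebra
  have hd : Module.finrank ℝ (unitarySubgroupLogChart Gs hG).lie =
      Module.finrank ℝ (matrixLieAlgebra (Set.range ρ)) := by rw [hlie]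
  obtain ⟨C, hC, h⟩ := haar_ball_two_sided_of_unitaryRep ρ hρc hρu hR
  refine ⟨C, hC, fun μ _ _ r hr hrR => ?_⟩
  rw [hd]
  exact h μ r hr hrR

end Upper

end Literature.MathematicalPhysics.QuantumFieldTheory.Balaban1983to89.HaarSmallBallClosedSubgroup

end
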